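import Mathlib
import Summits.AtomisticToContinuum.Crystallization.Theorems.BraggSlacknessRigidityHcpDiffractionRigidityEssentialPeriodicityRatAux3
import Summits.AtomisticToContinuum.Crystallization.Theorems.BraggSlacknessRigidityHcpDiffractionRigidityEssentialPeriodicityRatAux5

/-!
# Essential periodicity: the bound at one scale (stub `stub_essentialPeriodicityOfArith` of crux
# `HcpDiffractionRigidity`, item `stmt-AtomisticToContinuum-13166`, Aux file 6)

Ingredients of the generic essential-periodicity theorem (Aux file 7): for an `r`-separated
`Λ ⊆ ℝ³` with non-negative summable weights `c`, squared mass `MG = ∑' c²`, a vector `z₀` such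
that the non-zero `p - q - z₀` (`p, q ∈ Λ`) have norm `≥ r`, and `BAD = ∑'_{s + z₀ ∉ Λ} c(s)²`:

* small lemmas: minimal norm of a discrete `ℤ`-module, decay of the packing constant
  `τ(r,A) = e^{-πA²r²/2} · 2(2/r+1)³(8/A²+1)³`, Gaussian tails, a cutoff avoiding a set,
  second-order vanishing of `1 − cos 2π⟨ξ,z₀⟩` near points `κ` with `⟨κ, z₀⟩ ∈ ℤ`;
* `gauss_modulation_remainder_le` — pointwise domination
  `e^{-π|ξ|²/A²}(1 − cos 2π⟨ξ,z₀⟩)(1 − χ) ≤ η e^{-π|ξ|²/B²}` off the bulk of the cutoff `χ`;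
* `bad_le_of_bounds` / `stub_essentialPeriodicityOneScale` — THE BOUND AT ONE SCALE: if
  `τ(r,A) ≤ ε/16`, `|∫ gA χ |S|²| ≤ (ε/16)A³MG`, `gA(1 − χ) ≤ η e^{-π|ξ|²/B²}` and
  `η B³(1+τ(r,B)) ≤ (ε/8)A³`, then `BAD ≤ (ε/2) MG` (main inequality and upper Gaussian bound of
  Aux file 3).

All `[folklore]`.
-/

noncomputable section

namespace Summit.AtomisticToContinuum.Crystallization.Theorems

namespace HcpRigiditySpectral

open MeasureTheory Complex Filter Metric Set
open scoped BigOperators Real RealInnerProductSpace Topology Classical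
open Literature.MathematicalPhysics.StatisticalMechanics
open Summit.AtomisticToContinuum.Crystallization.Theorems.HcpRigidityDenseCentres
open Summit.AtomisticToContinuum.Crystallization.Theorems.HcpRigidityWindows
open Summit.AtomisticToContinuum.Crystallization.Theorems.HcpRigidityLocalLimit

/-! ## Small lemmas -/

/-- A discrete `ℤ`-submodule of `ℝ³` has a positive minimal norm. [folklore] -/
theorem exists_pos_le_norm_of_discrete (M : Submodule ℤ (EuclideanSpace ℝ (Fin 3)))
    [DiscreteTopology M] : ∃ r : ℝ, 0 < r ∧ ∀ m ∈ M, m ≠ 0 → r ≤ ‖m‖ := by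
  obtain ⟨ε, hε, hball⟩ := Metric.isOpen_singleton_iff.1 (isOpen_discrete ({0} : Set M))
  refine ⟨ε, hε, fun m hm hm0 => ?_⟩
  by_contra hlt
  rw [not_le] at hlt
  have h := hball ⟨m, hm⟩ (by simpa [dist_eq_norm] using hlt)
  exact hm0 (by simpa using congrArg Subtype.val h)

/-- Decay of the packing constant `τ(r,A) = e^{-πA²r²/2} · 2(2/r+1)³(8/A²+1)³` as `A → ∞`: for
every `ε > 0` some `A ≥ 1` has `τ(r, A) ≤ ε`. [folklore] -/
theorem exists_scale_tau_le {r ε : ℝ} (hr : 0 < r) (hε : 0 < ε) :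
    ∃ A : ℝ, 1 ≤ A ∧ Real.exp (-(Real.pi * A ^ 2 * r ^ 2 / 2)) *
      (2 * (2 / r + 1) ^ 3 * (8 / A ^ 2 + 1) ^ 3) ≤ ε := by
  -- for `A ≥ 1` the polynomial factor is at most `2(2/r+1)³ 9³`, and the exponential tends to `0`
  set Cst : ℝ := 2 * (2 / r + 1) ^ 3 * 9 ^ 3 with hCst
  have hCst0 : 0 < Cst := by positivity
  have hlim : Tendsto (fun A : ℝ => Real.exp (-(Real.pi * A ^ 2 * r ^ 2 / 2)) * Cst) atTop (𝓝 0) := by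
    have h1 : Tendsto (fun A : ℝ => Real.pi * A ^ 2 * r ^ 2 / 2) atTop atTop := by
      have : Tendsto (fun A : ℝ => (Real.pi * r ^ 2 / 2) * A ^ 2) atTop atTop :=
        Tendsto.const_mul_atTop (by positivity) (tendsto_pow_atTop two_ne_zero)
      refine this.congr fun A => by ring
    have h2 := Real.tendsto_exp_atBot.comp (tendsto_neg_atTop_atBot.comp h1)
    simpa using h2.mul_const Cst
  obtain ⟨A, hA, hA1⟩ := ((hlim.eventually (gt_mem_nhds hε)).and (eventually_ge_atTop 1)).exists
  refine ⟨A, hA1, le_trans ?_ hA.le⟩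
  have hA0 : 0 < A := by linarith
  have h8 : 8 / A ^ 2 + 1 ≤ 9 := by
    have : 8 / A ^ 2 ≤ 8 := by
      rw [div_le_iff₀ (by positivity)]; nlinarith
    linarith
  have h80 : 0 ≤ 8 / A ^ 2 + 1 := by positivity
  rw [hCst]
  have hexp : 0 ≤ Real.exp (-(Real.pi * A ^ 2 * r ^ 2 / 2)) := (Real.exp_pos _).le
  have hr3 : 0 ≤ 2 * (2 / r + 1) ^ 3 := by positivity
  calc Real.exp (-(Real.pi * A ^ 2 * r ^ 2 / 2)) * (2 * (2 / r + 1) ^ 3 * (8 / A ^ 2 + 1) ^ 3)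
      ≤ Real.exp (-(Real.pi * A ^ 2 * r ^ 2 / 2)) * (2 * (2 / r + 1) ^ 3 * 9 ^ 3) := by
        gcongr
    _ = _ := by ring

/-- Gaussian tails: for `B > 0`, `c` and `ε > 0` some `R ≥ 0` has `c e^{-πR²/B²} ≤ ε`. [folklore] -/
theorem exists_radius_mul_exp_le {B : ℝ} (hB : 0 < B) (c : ℝ) {ε : ℝ} (hε : 0 < ε) :
    ∃ R : ℝ, 0 ≤ R ∧ c * Real.exp (-(Real.pi * R ^ 2 / B ^ 2)) ≤ ε := by
  have h1 : Tendsto (fun R : ℝ => Real.pi * R ^ 2 / B ^ 2) atTop atTop := by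
    have : Tendsto (fun R : ℝ => (Real.pi / B ^ 2) * R ^ 2) atTop atTop :=
      Tendsto.const_mul_atTop (by positivity) (tendsto_pow_atTop two_ne_zero)
    refine this.congr fun R => by ring
  have h2 := (Real.tendsto_exp_atBot.comp (tendsto_neg_atTop_atBot.comp h1)).const_mul c
  rw [mul_zero] at h2
  obtain ⟨R, hR, hR0⟩ := ((h2.eventually (gt_mem_nhds hε)).and (eventually_ge_atTop 0)).exists
  exact ⟨R, hR0, hR.le⟩

/-- **A cutoff avoiding a set.** For `K ⊆ ℝ³`, `R` real and `ρ > 0` there is a continuous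
compactly supported `χ : ℝ³ → [0,1]` equal to `1` at every point of the ball `|ξ| ≤ R` outside
the open `ρ`-neighbourhood of `K`, whose topological support does not meet `K`. [folklore] -/
theorem exists_cutoff_avoiding (K : Set (EuclideanSpace ℝ (Fin 3))) (R : ℝ) {ρ : ℝ} (hρ : 0 < ρ) :
    ∃ χ : EuclideanSpace ℝ (Fin 3) → ℝ, Continuous χ ∧ HasCompactSupport χ ∧
      (∀ ξ, 0 ≤ χ ξ ∧ χ ξ ≤ 1) ∧ (∀ ξ, ‖ξ‖ ≤ R → ξ ∉ thickening ρ K → χ ξ = 1) ∧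
      ∀ ξ ∈ tsupport χ, ξ ∉ K := by
  set s : Set (EuclideanSpace ℝ (Fin 3)) := closedBall 0 R ∩ (thickening ρ K)ᶜ with hs
  set t : Set (EuclideanSpace ℝ (Fin 3)) := (ball 0 (R + 1))ᶜ ∪ cthickening (ρ / 2) K with ht
  have hsc : IsCompact s := (isCompact_closedBall 0 R).inter_right isOpen_thickening.isClosed_compl
  have htc : IsClosed t := isOpen_ball.isClosed_compl.union (isClosed_cthickening)
  have hdisj : Disjoint s t := by
    rw [Set.disjoint_left]
    rintro x ⟨hx1, hx2⟩ hx
    rcases hx with hx | hx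
    · apply hx
      rw [mem_ball_zero_iff]
      rw [mem_closedBall_zero_iff] at hx1
      linarith
    · exact hx2 (cthickening_subset_thickening' hρ (by linarith) K hx)
  obtain ⟨f, hf1, hf0, hfs, hf01⟩ := exists_continuous_one_zero_of_isCompact hsc htc hdisj
  refine ⟨f, f.continuous, hfs, fun ξ => ⟨(hf01 ξ).1, (hf01 ξ).2⟩, fun ξ hξR hξK => ?_,
    fun ξ hξ hξK => ?_⟩
  · have := hf1 ⟨mem_closedBall_zero_iff.2 hξR, hξK⟩
    simpa using this
  · -- the support avoids the open `ρ/2`-neighbourhood of `K`, which contains `K`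
    have hsupp : Function.support f ⊆ (thickening (ρ / 2) K)ᶜ := by
      intro ζ hζ hζK
      exact hζ (by simpa using hf0 (Or.inr (thickening_subset_cthickening _ _ hζK)))
    have hts : tsupport (f : EuclideanSpace ℝ (Fin 3) → ℝ) ⊆ (thickening (ρ / 2) K)ᶜ :=
      closure_minimal hsupp isOpen_thickening.isClosed_compl
    exact hts hξ (self_subset_thickening (by positivity) K hξK)

/-- **The modulation vanishes to second order on the periodised Bragg set.** If `⟨κ, z₀⟩ ∈ ℤ`
and `dist ξ κ < ρ`, then `1 − cos(2π⟨ξ, z₀⟩) ≤ 2π²ρ²|z₀|²`. [folklore] -/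
theorem one_sub_cos_le_of_near {ξ κ z₀ : EuclideanSpace ℝ (Fin 3)} {n : ℤ} (hn : ⟪κ, z₀⟫ = n)
    {ρ : ℝ} (h : dist ξ κ < ρ) :
    1 - Real.cos (2 * Real.pi * ⟪ξ, z₀⟫) ≤ 2 * Real.pi ^ 2 * ρ ^ 2 * ‖z₀‖ ^ 2 := by
  have hsplit : ⟪ξ, z₀⟫ = ⟪ξ - κ, z₀⟫ + n := by rw [inner_sub_left, hn]; ring
  have hcos : Real.cos (2 * Real.pi * ⟪ξ, z₀⟫) = Real.cos (2 * Real.pi * ⟪ξ - κ, z₀⟫) := by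
    rw [hsplit, mul_add, show 2 * Real.pi * (n : ℝ) = n * (2 * Real.pi) by ring,
      Real.cos_add_int_mul_two_pi]
  rw [hcos]
  have hb := Real.one_sub_sq_div_two_le_cos (x := 2 * Real.pi * ⟪ξ - κ, z₀⟫)
  have hi : |⟪ξ - κ, z₀⟫| ≤ ‖ξ - κ‖ * ‖z₀‖ := abs_real_inner_le_norm _ _
  have hd : ‖ξ - κ‖ < ρ := by rwa [← dist_eq_norm]
  have hρ : 0 ≤ ρ := le_of_lt (lt_of_le_of_lt dist_nonneg h)
  have h1 : ⟪ξ - κ, z₀⟫ ^ 2 ≤ ρ ^ 2 * ‖z₀‖ ^ 2 := by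
    have h2 : |⟪ξ - κ, z₀⟫| ≤ ρ * ‖z₀‖ :=
      hi.trans (mul_le_mul_of_nonneg_right hd.le (norm_nonneg _))
    have h3 : 0 ≤ ρ * ‖z₀‖ := by positivity
    nlinarith [abs_nonneg ⟪ξ - κ, z₀⟫, sq_abs ⟪ξ - κ, z₀⟫]
  nlinarith [Real.pi_pos.le, sq_nonneg Real.pi]

/-! ## Pointwise domination of the remainder -/

/-- **The remainder is dominated by a Gaussian.** Let `B² = 2A²`, `R ≥ 0`, let `K` be a set on
which `⟨·, z₀⟩` is integral, and `χ : ℝ³ → [0,1]` a cutoff equal to `1` on the ball `|ξ| ≤ R`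
outside the `ρ`-neighbourhood of `K`. Then
`e^{-π|ξ|²/A²}(1 − cos 2π⟨ξ,z₀⟩)(1 − χ(ξ)) ≤ (2e^{-πR²/B²} + 2π²ρ²|z₀|² e^{πR²/B²}) e^{-π|ξ|²/B²}`
(Gaussian tail for `|ξ| > R`; second-order vanishing of the modulation near `K`). [folklore] -/
theorem gauss_modulation_remainder_le {A B R ρ : ℝ} (hA : 0 < A) (hB : 0 < B)
    (hB2 : B ^ 2 = 2 * A ^ 2) (hR0 : 0 ≤ R) {K : Set (EuclideanSpace ℝ (Fin 3))}
    {z₀ : EuclideanSpace ℝ (Fin 3)} (hK : ∀ κ ∈ K, ∃ n : ℤ, ⟪κ, z₀⟫ = n)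
    {χ : EuclideanSpace ℝ (Fin 3) → ℝ} (hχ01 : ∀ ξ, 0 ≤ χ ξ ∧ χ ξ ≤ 1)
    (hχ1 : ∀ ξ, ‖ξ‖ ≤ R → ξ ∉ thickening ρ K → χ ξ = 1) (ξ : EuclideanSpace ℝ (Fin 3)) :
    Real.exp (-(Real.pi / A ^ 2) * ‖ξ‖ ^ 2) * (1 - Real.cos (2 * Real.pi * ⟪ξ, z₀⟫)) * (1 - χ ξ) ≤
      (2 * Real.exp (-(Real.pi * R ^ 2 / B ^ 2)) +
        2 * Real.pi ^ 2 * ρ ^ 2 * ‖z₀‖ ^ 2 * Real.exp (Real.pi * R ^ 2 / B ^ 2)) *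
      Real.exp (-(Real.pi / B ^ 2) * ‖ξ‖ ^ 2) := by
  -- abbreviations
  obtain ⟨eR, heRdef⟩ : ∃ eR : ℝ, eR = Real.exp (-(Real.pi * R ^ 2 / B ^ 2)) := ⟨_, rfl⟩
  obtain ⟨Egr, hEgrdef⟩ : ∃ Egr : ℝ, Egr = Real.exp (Real.pi * R ^ 2 / B ^ 2) := ⟨_, rfl⟩
  obtain ⟨GA, hGAdef⟩ : ∃ GA : ℝ, GA = Real.exp (-(Real.pi / A ^ 2) * ‖ξ‖ ^ 2) := ⟨_, rfl⟩
  obtain ⟨GB, hGBdef⟩ : ∃ GB : ℝ, GB = Real.exp (-(Real.pi / B ^ 2) * ‖ξ‖ ^ 2) := ⟨_, rfl⟩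
  obtain ⟨md, hmddef⟩ : ∃ md : ℝ, md = 1 - Real.cos (2 * Real.pi * ⟪ξ, z₀⟫) := ⟨_, rfl⟩
  rw [← heRdef, ← hEgrdef, ← hGAdef, ← hGBdef, ← hmddef]
  have heR0 : 0 < eR := by rw [heRdef]; exact Real.exp_pos _
  have hEgr0 : 0 < Egr := by rw [hEgrdef]; exact Real.exp_pos _
  have hEe : Egr * eR = 1 := by rw [hEgrdef, heRdef, ← Real.exp_add]; simp
  have hGA0 : 0 < GA := by rw [hGAdef]; exact Real.exp_pos _
  have hGB0 : 0 < GB := by rw [hGBdef]; exact Real.exp_pos _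
  have hGA1 : GA ≤ 1 := by
    rw [hGAdef, Real.exp_le_one_iff, neg_mul, neg_nonpos]; positivity
  have hmd0 : 0 ≤ md := by rw [hmddef]; linarith [Real.cos_le_one (2 * Real.pi * ⟪ξ, z₀⟫)]
  have hmd2 : md ≤ 2 := by rw [hmddef]; linarith [Real.neg_one_le_cos (2 * Real.pi * ⟪ξ, z₀⟫)]
  have hχ := hχ01 ξ
  have hle1 : GA * md * (1 - χ ξ) ≤ GA * md :=
    mul_le_of_le_one_right (mul_nonneg hGA0.le hmd0) (by linarith [hχ.1])
  have hpos1 : 0 ≤ 2 * eR * GB := by positivity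
  have hpos2 : 0 ≤ 2 * Real.pi ^ 2 * ρ ^ 2 * ‖z₀‖ ^ 2 * Egr * GB := by positivity
  by_cases hRξ : ‖ξ‖ ≤ R
  · -- inside the ball `G_B ≥ e^{-πR²/B²}`
    have hlow : eR ≤ GB := by
      rw [heRdef, hGBdef, Real.exp_le_exp]
      have h1 : ‖ξ‖ ^ 2 ≤ R ^ 2 := pow_le_pow_left₀ (norm_nonneg _) hRξ 2
      have h2 : Real.pi / B ^ 2 * ‖ξ‖ ^ 2 ≤ Real.pi / B ^ 2 * R ^ 2 :=
        mul_le_mul_of_nonneg_left h1 (by positivity)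
      have h3 : Real.pi * R ^ 2 / B ^ 2 = Real.pi / B ^ 2 * R ^ 2 := by ring
      rw [h3, neg_mul]
      linarith
    by_cases hth : ξ ∈ thickening ρ K
    · -- near `K`: the modulation is small
      obtain ⟨κ, hκ, hdist⟩ := mem_thickening_iff.1 hth
      obtain ⟨n, hn⟩ := hK κ hκ
      have hc : md ≤ 2 * Real.pi ^ 2 * ρ ^ 2 * ‖z₀‖ ^ 2 := by
        rw [hmddef]; exact one_sub_cos_le_of_near hn hdist
      have h2 : GA * md ≤ 2 * Real.pi ^ 2 * ρ ^ 2 * ‖z₀‖ ^ 2 := by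
        calc GA * md ≤ 1 * (2 * Real.pi ^ 2 * ρ ^ 2 * ‖z₀‖ ^ 2) := mul_le_mul hGA1 hc hmd0 zero_le_one
          _ = _ := one_mul _
      have h4 : 1 ≤ Egr * GB := by
        calc (1 : ℝ) = Egr * eR := hEe.symm
          _ ≤ Egr * GB := mul_le_mul_of_nonneg_left hlow hEgr0.le
      have h3 : 2 * Real.pi ^ 2 * ρ ^ 2 * ‖z₀‖ ^ 2 ≤ 2 * Real.pi ^ 2 * ρ ^ 2 * ‖z₀‖ ^ 2 * Egr * GB := by
        have h5 : 0 ≤ 2 * Real.pi ^ 2 * ρ ^ 2 * ‖z₀‖ ^ 2 := by positivity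
        calc 2 * Real.pi ^ 2 * ρ ^ 2 * ‖z₀‖ ^ 2 = 2 * Real.pi ^ 2 * ρ ^ 2 * ‖z₀‖ ^ 2 * 1 := (mul_one _).symm
          _ ≤ 2 * Real.pi ^ 2 * ρ ^ 2 * ‖z₀‖ ^ 2 * (Egr * GB) := mul_le_mul_of_nonneg_left h4 h5
          _ = _ := by ring
      calc GA * md * (1 - χ ξ) ≤ GA * md := hle1
        _ ≤ 2 * Real.pi ^ 2 * ρ ^ 2 * ‖z₀‖ ^ 2 * Egr * GB := h2.trans h3
        _ ≤ (2 * eR + 2 * Real.pi ^ 2 * ρ ^ 2 * ‖z₀‖ ^ 2 * Egr) * GB := by rw [add_mul]; linarith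
    · -- the bulk: `χ = 1`
      rw [hχ1 ξ hRξ hth, sub_self, mul_zero]
      positivity
  · -- the Gaussian tail: `G_A = G_B² ≤ e^{-πR²/B²} G_B`
    rw [not_le] at hRξ
    have ht : GA ≤ eR * GB := by
      rw [hGAdef, heRdef, hGBdef, ← Real.exp_add, Real.exp_le_exp]
      have h1 : R ^ 2 ≤ ‖ξ‖ ^ 2 := pow_le_pow_left₀ hR0 hRξ.le 2
      have hA2 : Real.pi / A ^ 2 = 2 * (Real.pi / B ^ 2) := by
        rw [hB2]; field_simp
      have h3 : Real.pi * R ^ 2 / B ^ 2 = Real.pi / B ^ 2 * R ^ 2 := by ring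
      rw [hA2, h3]
      have h4 : 0 < Real.pi / B ^ 2 := by positivity
      have h5 := mul_le_mul_of_nonneg_left h1 h4.le
      rw [neg_mul, neg_mul]
      linarith
    have h2 : GA * md ≤ eR * GB * 2 := mul_le_mul ht hmd2 hmd0 (by positivity)
    calc GA * md * (1 - χ ξ) ≤ GA * md := hle1
      _ ≤ eR * GB * 2 := h2
      _ ≤ (2 * eR + 2 * Real.pi ^ 2 * ρ ^ 2 * ‖z₀‖ ^ 2 * Egr) * GB := by rw [add_mul]; linarith

/-! ## The bound at one scale -/

/-- **The bound at one scale.** Let `Λ ⊆ ℝ³` be `r`-separated, `c ≥ 0` summable weights with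
squared mass `MG` and `BAD = ∑'_{s + z₀ ∉ Λ} c(s)²`, where the non-zero `p - q - z₀` have norm `≥ r`.
If `τ(r,A) ≤ ε/16`, the modulated Gaussian test function `gA = e^{-π|ξ|²/A²}(1 − cos 2π⟨ξ,z₀⟩)`
splits as `gA χ + gA(1 − χ)` with `|∫ gA χ |S|²| ≤ (ε/16)A³ MG` and `gA(1 − χ) ≤ η e^{-π|ξ|²/B²}`
pointwise, where `η B³(1 + τ(r,B)) ≤ (ε/8)A³`, then `BAD ≤ (ε/2) MG` (main inequality and upper
Gaussian bound of Aux file 3). [folklore] -/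
theorem bad_le_of_bounds {Λ : Set (EuclideanSpace ℝ (Fin 3))} {r : ℝ} (hr : 0 < r)
    (hΛ : ∀ p ∈ Λ, ∀ q ∈ Λ, p ≠ q → r ≤ dist p q) {c : EuclideanSpace ℝ (Fin 3) → ℝ}
    (hc0 : ∀ z, 0 ≤ c z) (hcs : Summable fun s : Λ => c s) {z₀ : EuclideanSpace ℝ (Fin 3)}
    (hz₀ : ∀ p ∈ Λ, ∀ q ∈ Λ, p - q - z₀ ≠ 0 → r ≤ ‖p - q - z₀‖) {A B ε η : ℝ} (hA : 0 < A)
    (hB : 0 < B) (hη0 : 0 ≤ η)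
    (hτA : Real.exp (-(Real.pi * A ^ 2 * r ^ 2 / 2)) * (2 * (2 / r + 1) ^ 3 * (8 / A ^ 2 + 1) ^ 3) ≤ ε / 16)
    (hηCB : η * (B ^ 3 * (1 + Real.exp (-(Real.pi * B ^ 2 * r ^ 2 / 2)) *
      (2 * (2 / r + 1) ^ 3 * (8 / B ^ 2 + 1) ^ 3))) ≤ ε / 16 * A ^ 3 + ε / 16 * A ^ 3)
    {χ : EuclideanSpace ℝ (Fin 3) → ℝ} (hχc : Continuous χ) (hχ01 : ∀ ξ, 0 ≤ χ ξ ∧ χ ξ ≤ 1)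
    (hdom : ∀ ξ : EuclideanSpace ℝ (Fin 3), Real.exp (-(Real.pi / A ^ 2) * ‖ξ‖ ^ 2) *
      (1 - Real.cos (2 * Real.pi * ⟪ξ, z₀⟫)) * (1 - χ ξ) ≤ η * Real.exp (-(Real.pi / B ^ 2) * ‖ξ‖ ^ 2))
    (hquiet : |∫ ξ : EuclideanSpace ℝ (Fin 3), Real.exp (-(Real.pi / A ^ 2) * ‖ξ‖ ^ 2) *
      (1 - Real.cos (2 * Real.pi * ⟪ξ, z₀⟫)) * χ ξ *
        ‖∑' s : Λ, (c s : ℂ) * cexp (2 * Real.pi * I * (⟪ξ, (s : EuclideanSpace ℝ (Fin 3))⟫ : ℂ))‖ ^ 2| ≤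
      ε / 16 * A ^ 3 * ∑' s : Λ, c s ^ 2) :
    (∑' s : Λ, if (s : EuclideanSpace ℝ (Fin 3)) + z₀ ∈ Λ then (0 : ℝ) else c s ^ 2) ≤
      ε / 2 * ∑' s : Λ, c s ^ 2 := by
  -- abbreviations
  obtain ⟨In, hIn⟩ : ∃ In : EuclideanSpace ℝ (Fin 3) → ℝ, ∀ ξ, In ξ =
      ‖∑' s : Λ, (c s : ℂ) * cexp (2 * Real.pi * I * (⟪ξ, (s : EuclideanSpace ℝ (Fin 3))⟫ : ℂ))‖ ^ 2 :=
    ⟨_, fun _ => rfl⟩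
  have hIn0 : ∀ ξ, 0 ≤ In ξ := fun ξ => by rw [hIn]; positivity
  obtain ⟨gA, hgAdef⟩ : ∃ gA : EuclideanSpace ℝ (Fin 3) → ℝ,
      gA = fun ξ => Real.exp (-(Real.pi / A ^ 2) * ‖ξ‖ ^ 2) * (1 - Real.cos (2 * Real.pi * ⟪ξ, z₀⟫)) :=
    ⟨_, rfl⟩
  have hgAval : ∀ ξ, gA ξ = Real.exp (-(Real.pi / A ^ 2) * ‖ξ‖ ^ 2) *
      (1 - Real.cos (2 * Real.pi * ⟪ξ, z₀⟫)) := fun ξ => by rw [hgAdef]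
  obtain ⟨GB, hGBdef⟩ : ∃ GB : EuclideanSpace ℝ (Fin 3) → ℝ,
      GB = fun ξ => Real.exp (-(Real.pi / B ^ 2) * ‖ξ‖ ^ 2) := ⟨_, rfl⟩
  have hGBval : ∀ ξ, GB ξ = Real.exp (-(Real.pi / B ^ 2) * ‖ξ‖ ^ 2) := fun ξ => by rw [hGBdef]
  obtain ⟨MG, hMGdef⟩ : ∃ MG : ℝ, MG = ∑' s : Λ, c s ^ 2 := ⟨_, rfl⟩
  obtain ⟨BAD, hBADdef⟩ : ∃ BAD : ℝ,
      BAD = ∑' s : Λ, if (s : EuclideanSpace ℝ (Fin 3)) + z₀ ∈ Λ then (0 : ℝ) else c s ^ 2 := ⟨_, rfl⟩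
  obtain ⟨τA, hτAdef⟩ : ∃ τA : ℝ, τA = Real.exp (-(Real.pi * A ^ 2 * r ^ 2 / 2)) *
      (2 * (2 / r + 1) ^ 3 * (8 / A ^ 2 + 1) ^ 3) := ⟨_, rfl⟩
  obtain ⟨CB, hCBdef⟩ : ∃ CB : ℝ, CB = B ^ 3 * (1 + Real.exp (-(Real.pi * B ^ 2 * r ^ 2 / 2)) *
      (2 * (2 / r + 1) ^ 3 * (8 / B ^ 2 + 1) ^ 3)) := ⟨_, rfl⟩
  rw [← hMGdef, ← hBADdef]
  rw [← hτAdef] at hτA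
  rw [← hCBdef] at hηCB
  rw [← hMGdef] at hquiet
  simp only [← hIn] at hquiet
  have hMG0 : 0 ≤ MG := by rw [hMGdef]; exact tsum_nonneg fun s => sq_nonneg _
  have hA3 : 0 < A ^ 3 := by positivity
  have hcos2 : ∀ ξ : EuclideanSpace ℝ (Fin 3), 0 ≤ 1 - Real.cos (2 * Real.pi * ⟪ξ, z₀⟫) ∧
      1 - Real.cos (2 * Real.pi * ⟪ξ, z₀⟫) ≤ 2 := fun ξ =>
    ⟨by linarith [Real.cos_le_one (2 * Real.pi * ⟪ξ, z₀⟫)],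
      by linarith [Real.neg_one_le_cos (2 * Real.pi * ⟪ξ, z₀⟫)]⟩
  -- the main inequality
  have hmain : A ^ 3 * (BAD / 2 - τA * MG) ≤ ∫ ξ, gA ξ * In ξ := by
    have h := integral_gauss_one_sub_cos_normSq_ge hr hΛ hA hc0 hcs hz₀
    rw [← hMGdef, ← hBADdef, ← hτAdef] at h
    simp only [← hIn, ← hgAval] at h
    exact h
  -- integrability
  have hgA_int : Integrable gA := by
    rw [hgAdef]
    refine (integrable_rexp_neg_mul_sq_norm (b := Real.pi / A ^ 2) (by positivity)).mul_bdd
      (c := 2) (Continuous.aestronglyMeasurable (by fun_prop)) (ae_of_all _ fun ξ => ?_)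
    rw [Real.norm_eq_abs, abs_of_nonneg (hcos2 ξ).1]
    exact (hcos2 ξ).2
  have hg_int : Integrable fun ξ => gA ξ * χ ξ := by
    refine hgA_int.mul_bdd (c := 1) hχc.aestronglyMeasurable (ae_of_all _ fun ξ => ?_)
    rw [Real.norm_eq_abs, abs_of_nonneg (hχ01 ξ).1]
    exact (hχ01 ξ).2
  have hrest_int : Integrable fun ξ => gA ξ * (1 - χ ξ) := by
    refine hgA_int.mul_bdd (c := 1) ((continuous_const.sub hχc).aestronglyMeasurable)
      (ae_of_all _ fun ξ => ?_)
    rw [Real.norm_eq_abs, abs_of_nonneg (by linarith [(hχ01 ξ).2])]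
    linarith [(hχ01 ξ).1]
  have hIg : Integrable fun ξ => gA ξ * χ ξ * In ξ := by
    simp only [hIn]
    exact integrable_mul_normSq_tsum hc0 hcs hg_int
  have hIrest : Integrable fun ξ => gA ξ * (1 - χ ξ) * In ξ := by
    simp only [hIn]
    exact integrable_mul_normSq_tsum hc0 hcs hrest_int
  have hIGB : Integrable fun ξ => GB ξ * In ξ := by
    simp only [hIn, hGBval]
    exact integrable_mul_normSq_tsum hc0 hcs
      (integrable_rexp_neg_mul_sq_norm (b := Real.pi / B ^ 2) (by positivity))
  -- splitting `gA = gA χ + gA (1 - χ)`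
  have hsplit : ∫ ξ, gA ξ * In ξ = (∫ ξ, gA ξ * χ ξ * In ξ) + ∫ ξ, gA ξ * (1 - χ ξ) * In ξ := by
    rw [← integral_add hIg hIrest]
    exact integral_congr_ae (ae_of_all _ fun ξ => by ring)
  -- the remainder is dominated by `η ∫ G_B |S|²`
  have hrest : ∫ ξ, gA ξ * (1 - χ ξ) * In ξ ≤ η * ∫ ξ, GB ξ * In ξ := by
    rw [← integral_const_mul]
    refine integral_mono hIrest (hIGB.const_mul η) fun ξ => ?_
    dsimp only
    rw [← mul_assoc]
    refine mul_le_mul_of_nonneg_right ?_ (hIn0 ξ)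
    rw [hgAval, hGBval]
    exact hdom ξ
  -- the Gaussian bound `∫ G_B |S|² ≤ C_B MG`
  have hGB : ∫ ξ, GB ξ * In ξ ≤ CB * MG := by
    have h := integral_gauss_normSq_le hr hΛ hB hc0 hcs
    rw [← hMGdef, ← hCBdef] at h
    simp only [← hIn, ← hGBval] at h
    exact h
  -- quietness of `gA χ`
  have hgt : ∫ ξ, gA ξ * χ ξ * In ξ ≤ ε / 16 * A ^ 3 * MG := by
    simp only [hgAval]
    exact (le_abs_self _).trans hquiet
  -- bookkeeping
  have P1 : τA * MG ≤ ε / 16 * MG := mul_le_mul_of_nonneg_right hτA hMG0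
  have P2 : η * ∫ ξ, GB ξ * In ξ ≤ η * (CB * MG) := mul_le_mul_of_nonneg_left hGB hη0
  have P3 : η * (CB * MG) ≤ (ε / 16 * A ^ 3 + ε / 16 * A ^ 3) * MG := by
    rw [← mul_assoc]; exact mul_le_mul_of_nonneg_right hηCB hMG0
  have P4 : A ^ 3 * (τA * MG) ≤ A ^ 3 * (ε / 16 * MG) := mul_le_mul_of_nonneg_left P1 hA3.le
  have hfinal : A ^ 3 * BAD ≤ A ^ 3 * (ε / 2 * MG) := by linarith
  exact le_of_mul_le_mul_left hfinal hA3

end HcpRigiditySpectral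

open scoped Classical in
open HcpRigiditySpectral in
/-- **Registered helper stub of `stub_essentialPeriodicityOfArith` (Aux file 6): the bound at one
scale.** For an `r`-separated `Λ ⊆ ℝ³`, weights `c ≥ 0` summable over `Λ`, `z₀` with
`|p - q - z₀| ≥ r` whenever `p, q ∈ Λ`, `p - q ≠ z₀`, scales `A, B > 0` with `τ(r,A) ≤ ε/16`, a
continuous cutoff `χ : ℝ³ → [0,1]` such that `gA(1 − χ) ≤ η e^{-π|ξ|²/B²}` pointwise
(`gA = e^{-π|ξ|²/A²}(1 − cos 2π⟨ξ,z₀⟩)`, `η ≥ 0`, `η B³(1+τ(r,B)) ≤ (ε/8)A³`) and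
`|∫ gA χ |S|²| ≤ (ε/16)A³ ∑' c²`: then `∑'_{s+z₀ ∉ Λ} c(s)² ≤ (ε/2) ∑' c²`. [folklore] -/
theorem stub_essentialPeriodicityOneScale : ∀ (r : ℝ), 0 < r → ∀ Λ : Set (EuclideanSpace ℝ (Fin 3)), (∀ p ∈ Λ, ∀ q ∈ Λ, p ≠ q → r ≤ dist p q) → ∀ c : EuclideanSpace ℝ (Fin 3) → ℝ, (∀ z, 0 ≤ c z) → Summable (fun s : Λ => c (s : EuclideanSpace ℝ (Fin 3))) → ∀ z₀ : EuclideanSpace ℝ (Fin 3), (∀ p ∈ Λ, ∀ q ∈ Λ, p - q - z₀ ≠ 0 → r ≤ ‖p - q - z₀‖) → ∀ (A B ε η : ℝ), 0 < A → 0 < B → 0 ≤ η → Real.exp (-(Real.pi * A ^ 2 * r ^ 2 / 2)) * (2 * (2 / r + 1) ^ 3 * (8 / A ^ 2 + 1) ^ 3) ≤ ε / 16 → η * (B ^ 3 * (1 + Real.exp (-(Real.pi * B ^ 2 * r ^ 2 / 2)) * (2 * (2 / r + 1) ^ 3 * (8 / B ^ 2 + 1) ^ 3))) ≤ ε / 16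 * A ^ 3 + ε / 16 * A ^ 3 → ∀ χ : EuclideanSpace ℝ (Fin 3) → ℝ, Continuous χ → (∀ ξ, 0 ≤ χ ξ ∧ χ ξ ≤ 1) → (∀ ξ : EuclideanSpace ℝ (Fin 3), Real.exp (-(Real.pi / A ^ 2) * ‖ξ‖ ^ 2) * (1 - Real.cos (2 * Real.pi * inner ℝ ξ z₀)) * (1 - χ ξ) ≤ η * Real.exp (-(Real.pi / B ^ 2) * ‖ξ‖ ^ 2)) → |∫ ξ : EuclideanSpace ℝ (Fin 3), Real.exp (-(Real.pi / A ^ 2) * ‖ξ‖ ^ 2) * (1 - Real.cos (2 * Real.pi * inner ℝ ξ z₀)) * χ ξ * ‖∑' s : Λ, (c (s : EuclideanSpace ℝ (Fin 3)) : ℂ) * Complex.exp (2 * Real.pi * Complex.I * (inner ℝ ξ (s : EuclideanSpace ℝ (Fin 3)) : ℂ))‖ ^ 2| ≤ ε / 16 * A ^ 3 * ∑' s : Λ, c (s : EuclideanSpace ℝ (Fin 3)) ^ 2 → (∑' s : Λ, if (s : EuclideanSpace ℝ (Fin 3)) + z₀ ∈ Λ then (0 : ℝ) else c (s : EuclideanSpace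 ℝ (Fin 3)) ^ 2) ≤ ε / 2 * ∑' s : Λ, c (s : EuclideanSpace ℝ (Fin 3)) ^ 2 :=
  fun _ hr _ hΛ _ hc0 hcs _ hz₀ _ _ _ _ hA hB hη0 hτA hηCB _ hχc hχ01 hdom hquiet =>
    bad_le_of_bounds hr hΛ hc0 hcs hz₀ hA hB hη0 hτA hηCB hχc hχ01 hdom hquiet

end Summit.AtomisticToContinuum.Crystallization.Theorems

end
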